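import Summits.BirchSwinnertonDyer.Rank1Residual.X2.Cells
import Summits.BirchSwinnertonDyer.Rank1Residual.X1.LambdaSqueezeAlgebra
import Literature.NumberTheory.EllipticCurves.PAdicLFunctionMultiplicativeInterpolation
import Literature.NumberTheory.EllipticCurves.IwasawaLeadingTermProofs
import HarnessLib

/-!
# Class X2 (odd multiplicative Eisenstein prime): the analytic `μ`- and `λ`-invariants at `p ‖ N`,
# TYPED, and the `Λ`-algebra of the parity squeeze with a trivial-zero prefactor
# (cell `b2b-bsdres`, unit `b2b-bsdres-eisenstein-p2`, gen 4)

HONEST FRAMING (run/shared/lean/b2b/bsd-rank1-residual/, verbatim in every file): the goal of the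
cell is to DELETE the COMBINATION-SHAPED residual classes of the Birch–Swinnerton-Dyer formula for
ALL analytic-rank `≤ 1` elliptic curves over `ℚ` — "full BSD formula for every rank `≤ 1` curve in
class `C`" assembled STRICTLY from published theorems — so that the rank-`≤ 1` remainder becomes
exactly the CONSTRUCTION-SHAPED classes, which are TYPED (missing-input `Prop`s), NOT attempted.
This is not "finishing BSD". Research routes; NO CLAIM BEYOND STATED CLASSES; nothing here changes
a label. TWO typed defs (per-pair FINITE checks; nothing asserted) and pure algebra; no named fact.

WHY THIS FILE. It is the vocabulary of `X2/ParitySqueeze.lean` (route P — Greenberg's parity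
squeeze, LNM 1716 Prop. 3.10 + §5 p. 183 — transposed from the good-ordinary leaf X1 ∩ {r = 0}
(`X1/ParitySqueeze.lean`, sub-cell `eisenstein-p1` gen 5) to sub-cell X2b at `p ‖ N`):

* `X2.AnalyticMuLE W p m`, `X2.AnalyticLambdaEq W p n` — "`μ_an ≤ m`", "`λ_an = n`" for THE
  Mazur–Tate–Teitelbaum `p`-adic `L`-function `L` of `E` at a MULTIPLICATIVE prime, Néron-normalised
  (`ϖ·L`, `ϖ·Ω_E = Ω⁺_f`, exactly the data of `X2.MazurMainConjectureAt`): split `p` —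
  `IsSplitMultPAdicLFunctionOf f p L` (allowable root `α = a_p = 1`, TRIVIAL ZERO INCLUDED, so
  `λ_an ≥ 1 + ord_{s=1}L(E,s)`); non-split `p` — `IsMultPAdicLFunctionOf f p (−1) L`. The
  multiplicative twins of `X1.MuPart.AnalyticMuLE` / `X1.ParitySqueeze.AnalyticLambdaEq` (which read
  the prelude's good-reduction `padicLFunction f α` and do not apply at `p ∣ N`).
* `μ(T) = 0`, `λ(T) = 1`; `μ(u·h·f) = 0 ⇒` all three `μ` vanish; the squeeze with a prefactor
  (`isUnit_of_lam_mul_mul_eq`: `λ(u) = k`, `λ(u·h·f) = k + 2`, `λ(f)` even `≠ 0` ⇒ `h ∈ Λˣ`);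
  `ord_p log_p κ(γ) = 1`; `ϖ ≠ 0` at any level.

References: [GreenbergVatsal2000] (1)–(2); [MazurTateTeitelbaum1986] §I.10, §I.14;
[GreenbergLNM1716] §5 p. 183; [Washington1997] §7.1; [Iwasawa1972PadicL] §4.4;
HOME/b2b-bsdres-eisenstein-p2/X2-GAP.md §9.
-/

set_option autoImplicit false

noncomputable section

open scoped Classical MatrixGroups ModularForm

open PowerSeries CongruenceSubgroup WeierstrassCurve Literature.NumberTheory.EllipticCurves
  Literature.NumberTheory.EllipticCurves.ModularForms
  Summit.BirchSwinnertonDyer.Rank1Residual.X1.MuLambda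
  Summit.BirchSwinnertonDyer.Rank1Residual.X1.ParitySqueeze

namespace Summit.BirchSwinnertonDyer.Rank1Residual.X2

/-! ## §1. The analytic invariants at a multiplicative prime, TYPED (finite checks; nothing asserted) -/

/-- **"`μ_an(E,p) ≤ m`" at a MULTIPLICATIVE prime `p` (TYPED; nothing asserted).** For every newform
`f` of `W` (any level), every rational `ϖ` with `ϖ·Ω_E = Ω⁺_f` (the Néron normalisation of
`X2.MazurMainConjectureAt`) and THE Mazur–Tate–Teitelbaum `p`-adic `L`-function `L` of `f` at the
multiplicative prime — `IsSplitMultPAdicLFunctionOf f p L` if `p` is split (allowable root `α = a_p = 1`,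
trivial zero included), `IsMultPAdicLFunctionOf f p (−1) L` otherwise (`α = a_p = −1`) —: SOME
coefficient of `ϖ·L` has `p`-adic norm `> p^{-(m+1)}`, i.e. `p^{m+1} ∤ ϖ·L_p(E,T)` coefficientwise,
the analytic μ-invariant (Greenberg–Vatsal (2)) is `≤ m`. A FINITE check on one coefficient; the
multiplicative twin of `X1.MuPart.AnalyticMuLE`. [cite: GreenbergVatsal2000, p. 2, (2) (shape only; nothing asserted)]
[cite: MazurTateTeitelbaum1986, §I.14 (shape only; nothing asserted)] -/
def AnalyticMuLE (W : WeierstrassCurve ℚ) [W.IsElliptic] [W.IsGloballyMinimal] (p : ℕ)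
    [Fact p.Prime] (m : ℕ) : Prop :=
  ∀ {N : ℕ} [NeZero N] (f : CuspForm (Gamma0 N) 2), IsNewformOf W f →
    ∀ (ϖ : ℚ), (ϖ : ℝ) * W.realPeriodRat = plusPeriod f →
    ∀ (L : PowerSeries ℚ_[p]),
      (W.HasSplitMultiplicativeReductionAtPrime p → IsSplitMultPAdicLFunctionOf f p L) →
      (¬ W.HasSplitMultiplicativeReductionAtPrime p → IsMultPAdicLFunctionOf f p (-1) L) →
      ∃ k : ℕ, (p : ℝ) ^ (-((m : ℤ) + 1)) <
        ‖PowerSeries.coeff k (PowerSeries.C ((ϖ : ℚ) : ℚ_[p]) * L)‖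

/-- **"`λ_an(E,p) = n`" at a MULTIPLICATIVE prime `p` (TYPED; nothing asserted).** Same data as
`AnalyticMuLE`; conclusion: every `G ∈ Λ = ℤ_p⟦T⟧` with `ι(G) = ϖ·L` (unique, `ι` injective; it
exists by Wuthrich 2014 Thm. 16: `G = T^e·g`, `g ∈ char_Λ X`) has `λ(G) = n` — the analytic
λ-invariant in Greenberg–Vatsal's notation (1), TRIVIAL ZERO INCLUDED (so at a split prime
`λ_an ≥ 1 + ord_{s=1}L(E,s)`). A FINITE check (the first `n + 1` coefficients of `ϖ·L/p^{μ}` mod `p`);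
the multiplicative twin of `X1.ParitySqueeze.AnalyticLambdaEq`.
[cite: GreenbergVatsal2000, p. 2–3, (1)–(2) (shape only; nothing asserted)]
[cite: MazurTateTeitelbaum1986, §I.14 (shape only; nothing asserted)] -/
def AnalyticLambdaEq (W : WeierstrassCurve ℚ) [W.IsElliptic] [W.IsGloballyMinimal] (p : ℕ)
    [Fact p.Prime] (n : ℕ) : Prop :=
  ∀ {N : ℕ} [NeZero N] (f : CuspForm (Gamma0 N) 2), IsNewformOf W f →
    ∀ (ϖ : ℚ), (ϖ : ℝ) * W.realPeriodRat = plusPeriod f →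
    ∀ (L : PowerSeries ℚ_[p]),
      (W.HasSplitMultiplicativeReductionAtPrime p → IsSplitMultPAdicLFunctionOf f p L) →
      (¬ W.HasSplitMultiplicativeReductionAtPrime p → IsMultPAdicLFunctionOf f p (-1) L) →
    ∀ (G : IwasawaAlgebra p),
      iwasawaToPowerSeries p G = PowerSeries.C ((ϖ : ℚ) : ℚ_[p]) * L → lam G = n

/-! ## §2. `Λ`-algebra: `μ`, `λ` of `T`, and the squeeze with a prefactor -/

section Algebra

variable {p : ℕ} [Fact p.Prime]

/-- `μ(T) = 0` and the `p`-free part of `T` is `T` (`T ≢ 0 (mod p)`). [folklore] -/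
theorem mu_X_eq_zero_and_pfree_X :
    mu (PowerSeries.X : IwasawaAlgebra p) = 0 ∧ pfree (PowerSeries.X : IwasawaAlgebra p) = X := by
  refine mu_eq_and_pfree_eq (a := 0) ?_ (by rw [pow_zero, map_one, one_mul])
  rw [Ne, red, PowerSeries.map_X]
  exact PowerSeries.X_ne_zero

/-- `λ(T) = 1` (`T` is the distinguished polynomial of degree `1`). [folklore] -/
theorem lam_X : lam (PowerSeries.X : IwasawaAlgebra p) = 1 := by
  rw [lam, mu_X_eq_zero_and_pfree_X.2, red, PowerSeries.map_X, PowerSeries.order_X]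
  rfl

/-- Units have `μ = 0`. [folklore] -/
theorem mu_eq_zero_of_isUnit {u : IwasawaAlgebra p} (hu : IsUnit u) : mu u = 0 :=
  ((isUnit_iff_mu_eq_zero_and_lam_eq_zero u).mp hu).2.1

/-- If `μ(u·(h·f)) = 0` (all three nonzero) then `μ(u) = μ(h) = μ(f) = 0` (`μ` is additive).
[cite: Washington1997, §7.1] -/
theorem mu_eq_zero_of_mu_mul_mul_eq_zero {u h f : IwasawaAlgebra p} (hu : u ≠ 0) (hh : h ≠ 0)
    (hf : f ≠ 0) (h0 : mu (u * (h * f)) = 0) : mu u = 0 ∧ mu h = 0 ∧ mu f = 0 := by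
  rw [mu_mul hu (mul_ne_zero hh hf), mu_mul hh hf] at h0
  omega

/-- **The parity squeeze with a prefactor (pure algebra).** Let `u, h, f ∈ Λ` be nonzero with
`λ(u) = k` (e.g. `u = T^e`), `μ(u·h·f) = 0`, `λ(u·h·f) = k + 2`, `λ(f)` even and `λ(f) ≠ 0`. Then
`h ∈ Λˣ` and `λ(f) = 2`: Greenberg's count at `147b1@13` (LNM 1716 p. 183) with the trivial-zero
factor `u` split off. [cite: GreenbergLNM1716, §5 p. 183 (Conductor = 147, p = 13)] -/
theorem isUnit_of_lam_mul_mul_eq {u h f : IwasawaAlgebra p} {k : ℕ} (hu : u ≠ 0) (hh : h ≠ 0)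
    (hf : f ≠ 0) (hlu : lam u = k) (hμ : mu (u * (h * f)) = 0) (hl : lam (u * (h * f)) = k + 2)
    (heven : Even (lam f)) (hne : lam f ≠ 0) : IsUnit h ∧ lam f = 2 := by
  obtain ⟨-, hμh, -⟩ := mu_eq_zero_of_mu_mul_mul_eq_zero hu hh hf hμ
  rw [lam_mul hu (mul_ne_zero hh hf), lam_mul hh hf, hlu] at hl
  obtain ⟨j, hj⟩ := heven
  have hlf : lam f = 2 := by omega
  have hlh : lam h = 0 := by omega
  exact ⟨(isUnit_iff_mu_eq_zero_and_lam_eq_zero h).mpr ⟨hh, hμh, hlh⟩, hlf⟩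

/-- `log_p κ(γ) = log_p(1 + p)` is nonzero of valuation `1` for odd `p` (tree:
`exists_unit_padicLog_cyclotomicGenerator`, Iwasawa 1972 §4.4). [cite: Iwasawa1972PadicL, §4.4] -/
theorem valuation_padicLog_cyclotomicGenerator (hp : p ≠ 2) :
    padicLog p (cyclotomicGenerator p : ℚ_[p]) ≠ 0 ∧
      (padicLog p (cyclotomicGenerator p : ℚ_[p])).valuation = 1 := by
  have hpP : p.Prime := Fact.out
  obtain ⟨u, hu⟩ := exists_unit_padicLog_cyclotomicGenerator p hp
  have hp0 : (p : ℚ_[p]) ≠ 0 := Nat.cast_ne_zero.mpr hpP.ne_zero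
  rw [hu]
  refine ⟨mul_ne_zero hp0 (coe_units_ne_zero p u), ?_⟩
  rw [Padic.valuation_mul hp0 (coe_units_ne_zero p u), Padic.valuation_p,
    valuation_coe_units_eq_zero, add_zero]

/-- A natural number not divisible by `p` has `p`-adic valuation `0` in `ℚ_p`; in particular
`ord_p 2 = 0` for odd `p` (the factor `ε_p = 1 − a_p⁻¹ = 2` of a non-split prime is a unit). [folklore] -/
theorem valuation_two_eq_zero (hp : p ≠ 2) : (2 : ℚ_[p]).valuation = 0 := by
  have hpP : p.Prime := Fact.out
  have e : ((2 : ℕ) : ℚ_[p]) = 2 := by norm_num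
  rw [← e, Padic.valuation_natCast]
  have : padicValNat p 2 = 0 := padicValNat.eq_zero_of_not_dvd
    (fun h ↦ hp ((Nat.prime_dvd_prime_iff_eq hpP Nat.prime_two).mp h))
  exact_mod_cast this

end Algebra

section Varpi

variable {W : WeierstrassCurve ℚ}

/-- `ϖ ≠ 0` when `ϖ · Ω_E = Ω⁺_f` (`Ω⁺_f > 0`, tree `IsNewform0.plusPeriod_pos_holds`), any level.
[folklore] -/
theorem varpi_ne_zero_of_isNewformOf {N : ℕ} [NeZero N] {f : CuspForm (Gamma0 N) 2}
    (hf : IsNewformOf W f) {ϖ : ℚ} (hϖ : (ϖ : ℝ) * W.realPeriodRat = plusPeriod f) : ϖ ≠ 0 := by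
  rintro rfl
  have hper : 0 < plusPeriod f := IsNewform0.plusPeriod_pos_holds hf.1 hf.coeffField_eq_bot
  rw [← hϖ, Rat.cast_zero, zero_mul] at hper
  exact lt_irrefl _ hper

end Varpi

end Summit.BirchSwinnertonDyer.Rank1Residual.X2

end
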